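import Mathlib
import Summits.PneNP.PneNP.Theorems.OverlapGapAlgebraSolvableImpliesStableSectionTwoWayRepairWeightStep

/-!
# PneNP / OverlapGapAlgebra — crux `SolvableImpliesStableSection` (stmt-PneNP-2463):
# the TWO-WAY REPAIR block (3b/·) — tree codes: weight of the odd roots, round zero, base

Support for crux `stmt-PneNP-2463` (`Summit.PneNP.PneNP.Theses.OverlapGapAlgebra.SolvableImpliesStableSection`):
the f-free block "bounded-round two-way repair with one-round memory gives stable sections for every
`ν > 0` up to `α ≤ 2^k/(4k)`".  Labels carry codes `c = 2·round + τ`; write `U` for the locally valid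
codes of `TS d` with a childless root slot (a unique one if the root code is odd) and root round
`< r/2`, and `Rec ⊆ U` for those of root round `r/2 - 1`.  Total weight
(`wt(T) = ∏_e 2^{-k}·(1 | 1/n)`) of the locally valid codes of `TS (d+1)` with root code `r`:

* (`sissW_weight_recent`, in `…TwoWayRepairWeightStep` — recent roots:
  `≤ m·k·2^{-k}·(∑_{Rec} wt/n)·(1 + ∑_U wt/n)^{k-1}`);
* `sissW_weight_odd` — with a recent child and EXACTLY ONE childless root slot (odd roots):
  `≤ m·k·k·2^{-k}·(∑_{Rec} wt/n)·(∑_U wt/n)^{k-2}`;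
* `sissW_weight_zero` — root round `0` with the uniqueness constraint (`k ≥ 2`): `≤ m·2^{-k}`;
* `sissW_weight_base_empty` — no bare root of round `≥ 1` is locally valid.
No definitions (all objects are hypotheses); axioms `propext`, `Classical.choice`, `Quot.sound`.
-/

set_option linter.dupNamespace false -- `Summit.PneNP.PneNP.…`: summit = sub-problem (D-0017)

namespace Summit.PneNP.PneNP.Theorems

open Finset
open scoped Classical

section WeightStepOdd

variable {m k n : ℕ}
/-- **Weight of the recent roots with exactly one childless slot (odd codes).** The locally valid
codes of `TS (d+1)` with root code `r`, a child of round `r/2 - 1` at the root and exactly one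
childless root slot have total weight at most `m·k·k·2^{-k}·(∑_{Rec} wt / n)·(∑_U wt / n)^{k-2}`. -/
theorem sissW_weight_odd (asm : Fin m → ℕ → (Fin k → Option (Finset (List (Fin k) × (Fin m × ℕ)))) → Finset (List (Fin k) × (Fin m × ℕ)))
    (hasm : ∀ (c : Fin m) (r : ℕ) (ch : Fin k → Option (Finset (List (Fin k) × (Fin m × ℕ))))
      (e : (List (Fin k) × (Fin m × ℕ))), e ∈ asm c r ch ↔ (e = ([], (c, r)) ∨
      ∃ (j : Fin k) (S : Finset (List (Fin k) × (Fin m × ℕ))), ch j = some S ∧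
        ∃ b : List (Fin k), (b, e.2) ∈ S ∧ e.1 = b ++ [j]))
    (TS : ℕ → Finset (Finset (List (Fin k) × (Fin m × ℕ)))) (L : ℕ)
    (hTS0 : ∀ T : Finset (List (Fin k) × (Fin m × ℕ)), T ∈ TS 0 ↔
      ∃ (c : Fin m) (r : ℕ), r ≤ L ∧ T = asm c r (fun _ => none))
    (hTSs : ∀ (d : ℕ) (T : Finset (List (Fin k) × (Fin m × ℕ))), T ∈ TS (d + 1) ↔
      ∃ (c : Fin m) (r : ℕ), r ≤ L ∧ ∃ ch : Fin k → Option (Finset (List (Fin k) × (Fin m × ℕ))),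
        (∀ (j : Fin k) (S : Finset (List (Fin k) × (Fin m × ℕ))), ch j = some S → S ∈ TS d) ∧ T = asm c r ch)
    (d r : ℕ) :
    ∑ T ∈ (TS (d + 1)).filter (fun T => (((∀ e ∈ T, ∀ (j : Fin k) (y : Fin m) (s : ℕ), (j :: e.1, (y, s)) ∈ T →
        s / 2 < e.2.2 / 2 ∧ ∃ j' : Fin k, ∀ lab : Fin m × ℕ, (j' :: j :: e.1, lab) ∉ T) ∧
      (∀ e ∈ T, ∀ (j : Fin k) (y : Fin m) (s : ℕ), (j :: e.1, (y, s)) ∈ T → s % 2 = 1 →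
        ∀ j₁ j₂ : Fin k, (∀ lab : Fin m × ℕ, (j₁ :: j :: e.1, lab) ∉ T) →
          (∀ lab : Fin m × ℕ, (j₂ :: j :: e.1, lab) ∉ T) → j₁ = j₂) ∧
      (∀ e ∈ T, 1 ≤ e.2.2 / 2 → ∃ (j : Fin k) (y : Fin m) (s : ℕ),
        (j :: e.1, (y, s)) ∈ T ∧ s / 2 + 1 = e.2.2 / 2))) ∧
        (∃ y : Fin m, (([] : List (Fin k)), (y, r)) ∈ T) ∧
        (∃ (j : Fin k) (y : Fin m) (s : ℕ), ([j], (y, s)) ∈ T ∧ s / 2 + 1 = r / 2) ∧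
        ∃ j₀ : Fin k, (∀ lab : Fin m × ℕ, ([j₀], lab) ∉ T) ∧
          ∀ j : Fin k, j ≠ j₀ → ∃ lab : Fin m × ℕ, ([j], lab) ∈ T), (∏ e ∈ T, ((1 / 2 : ℝ) ^ k * (if e.1 = [] then (1 : ℝ) else 1 / (n : ℝ))))
      ≤ (m : ℝ) * k * k * (1 / 2 : ℝ) ^ k *
        ((∑ S ∈ (TS d).filter (fun S => (((∀ e ∈ S, ∀ (j : Fin k) (y : Fin m) (s : ℕ), (j :: e.1, (y, s)) ∈ S →
        s / 2 < e.2.2 / 2 ∧ ∃ j' : Fin k, ∀ lab : Fin m × ℕ, (j' :: j :: e.1, lab) ∉ S) ∧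
      (∀ e ∈ S, ∀ (j : Fin k) (y : Fin m) (s : ℕ), (j :: e.1, (y, s)) ∈ S → s % 2 = 1 →
        ∀ j₁ j₂ : Fin k, (∀ lab : Fin m × ℕ, (j₁ :: j :: e.1, lab) ∉ S) →
          (∀ lab : Fin m × ℕ, (j₂ :: j :: e.1, lab) ∉ S) → j₁ = j₂) ∧
      (∀ e ∈ S, 1 ≤ e.2.2 / 2 → ∃ (j : Fin k) (y : Fin m) (s : ℕ),
        (j :: e.1, (y, s)) ∈ S ∧ s / 2 + 1 = e.2.2 / 2))) ∧ (∃ j : Fin k, ∀ lab : Fin m × ℕ, ([j], lab) ∉ S) ∧ ((∀ (y : Fin m) (s : ℕ), (([] : List (Fin k)), (y, s)) ∈ S → s % 2 = 1 →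
        ∀ j₁ j₂ : Fin k, (∀ lab : Fin m × ℕ, ([j₁], lab) ∉ S) →
          (∀ lab : Fin m × ℕ, ([j₂], lab) ∉ S) → j₁ = j₂)) ∧
            ∃ (y : Fin m) (s : ℕ), (([] : List (Fin k)), (y, s)) ∈ S ∧ s / 2 + 1 = r / 2), (∏ e ∈ S, ((1 / 2 : ℝ) ^ k * (if e.1 = [] then (1 : ℝ) else 1 / (n : ℝ))))) / n) *
        ((∑ S ∈ (TS d).filter (fun S => (((∀ e ∈ S, ∀ (j : Fin k) (y : Fin m) (s : ℕ), (j :: e.1, (y, s)) ∈ S →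
        s / 2 < e.2.2 / 2 ∧ ∃ j' : Fin k, ∀ lab : Fin m × ℕ, (j' :: j :: e.1, lab) ∉ S) ∧
      (∀ e ∈ S, ∀ (j : Fin k) (y : Fin m) (s : ℕ), (j :: e.1, (y, s)) ∈ S → s % 2 = 1 →
        ∀ j₁ j₂ : Fin k, (∀ lab : Fin m × ℕ, (j₁ :: j :: e.1, lab) ∉ S) →
          (∀ lab : Fin m × ℕ, (j₂ :: j :: e.1, lab) ∉ S) → j₁ = j₂) ∧
      (∀ e ∈ S, 1 ≤ e.2.2 / 2 → ∃ (j : Fin k) (y : Fin m) (s : ℕ),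
        (j :: e.1, (y, s)) ∈ S ∧ s / 2 + 1 = e.2.2 / 2))) ∧ (∃ j : Fin k, ∀ lab : Fin m × ℕ, ([j], lab) ∉ S) ∧ ((∀ (y : Fin m) (s : ℕ), (([] : List (Fin k)), (y, s)) ∈ S → s % 2 = 1 →
        ∀ j₁ j₂ : Fin k, (∀ lab : Fin m × ℕ, ([j₁], lab) ∉ S) →
          (∀ lab : Fin m × ℕ, ([j₂], lab) ∉ S) → j₁ = j₂)) ∧
            ∃ (y : Fin m) (s : ℕ), (([] : List (Fin k)), (y, s)) ∈ S ∧ s / 2 < r / 2), (∏ e ∈ S, ((1 / 2 : ℝ) ^ k * (if e.1 = [] then (1 : ℝ) else 1 / (n : ℝ))))) / n) ^ (k - 2) := by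
  set U : Finset (Finset (List (Fin k) × (Fin m × ℕ))) := (TS d).filter (fun S => (((∀ e ∈ S, ∀ (j : Fin k) (y : Fin m) (s : ℕ), (j :: e.1, (y, s)) ∈ S →
        s / 2 < e.2.2 / 2 ∧ ∃ j' : Fin k, ∀ lab : Fin m × ℕ, (j' :: j :: e.1, lab) ∉ S) ∧
      (∀ e ∈ S, ∀ (j : Fin k) (y : Fin m) (s : ℕ), (j :: e.1, (y, s)) ∈ S → s % 2 = 1 →
        ∀ j₁ j₂ : Fin k, (∀ lab : Fin m × ℕ, (j₁ :: j :: e.1, lab) ∉ S) →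
          (∀ lab : Fin m × ℕ, (j₂ :: j :: e.1, lab) ∉ S) → j₁ = j₂) ∧
      (∀ e ∈ S, 1 ≤ e.2.2 / 2 → ∃ (j : Fin k) (y : Fin m) (s : ℕ),
        (j :: e.1, (y, s)) ∈ S ∧ s / 2 + 1 = e.2.2 / 2))) ∧ (∃ j : Fin k, ∀ lab : Fin m × ℕ, ([j], lab) ∉ S) ∧ ((∀ (y : Fin m) (s : ℕ), (([] : List (Fin k)), (y, s)) ∈ S → s % 2 = 1 →
        ∀ j₁ j₂ : Fin k, (∀ lab : Fin m × ℕ, ([j₁], lab) ∉ S) →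
          (∀ lab : Fin m × ℕ, ([j₂], lab) ∉ S) → j₁ = j₂)) ∧
      ∃ (y : Fin m) (s : ℕ), (([] : List (Fin k)), (y, s)) ∈ S ∧ s / 2 < r / 2) with hU
  set Rec : Finset (Finset (List (Fin k) × (Fin m × ℕ))) := (TS d).filter (fun S => (((∀ e ∈ S, ∀ (j : Fin k) (y : Fin m) (s : ℕ), (j :: e.1, (y, s)) ∈ S →
        s / 2 < e.2.2 / 2 ∧ ∃ j' : Fin k, ∀ lab : Fin m × ℕ, (j' :: j :: e.1, lab) ∉ S) ∧
      (∀ e ∈ S, ∀ (j : Fin k) (y : Fin m) (s : ℕ), (j :: e.1, (y, s)) ∈ S → s % 2 = 1 →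
        ∀ j₁ j₂ : Fin k, (∀ lab : Fin m × ℕ, (j₁ :: j :: e.1, lab) ∉ S) →
          (∀ lab : Fin m × ℕ, (j₂ :: j :: e.1, lab) ∉ S) → j₁ = j₂) ∧
      (∀ e ∈ S, 1 ≤ e.2.2 / 2 → ∃ (j : Fin k) (y : Fin m) (s : ℕ),
        (j :: e.1, (y, s)) ∈ S ∧ s / 2 + 1 = e.2.2 / 2))) ∧ (∃ j : Fin k, ∀ lab : Fin m × ℕ, ([j], lab) ∉ S) ∧ ((∀ (y : Fin m) (s : ℕ), (([] : List (Fin k)), (y, s)) ∈ S → s % 2 = 1 →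
        ∀ j₁ j₂ : Fin k, (∀ lab : Fin m × ℕ, ([j₁], lab) ∉ S) →
          (∀ lab : Fin m × ℕ, ([j₂], lab) ∉ S) → j₁ = j₂)) ∧
      ∃ (y : Fin m) (s : ℕ), (([] : List (Fin k)), (y, s)) ∈ S ∧ s / 2 + 1 = r / 2) with hRec
  set f : Option (Finset (List (Fin k) × (Fin m × ℕ))) → ℝ := fun o => o.elim (1 : ℝ) (fun S => (∏ e ∈ S, ((1 / 2 : ℝ) ^ k * (if e.1 = [] then (1 : ℝ) else 1 / (n : ℝ)))) / n) with hf
  set t : Fin k × Fin k → Fin k → Finset (Option (Finset (List (Fin k) × (Fin m × ℕ)))) := fun q j =>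
    if j = q.1 then {none} else if j = q.2 then Rec.image some else U.image some with ht
  have hU0 : 0 ≤ (∑ S ∈ U, (∏ e ∈ S, ((1 / 2 : ℝ) ^ k * (if e.1 = [] then (1 : ℝ) else 1 / (n : ℝ))))) / n :=
    div_nonneg (Finset.sum_nonneg fun S _ => sissR_wt_nonneg S) (Nat.cast_nonneg _)
  have hR0 : 0 ≤ (∑ S ∈ Rec, (∏ e ∈ S, ((1 / 2 : ℝ) ^ k * (if e.1 = [] then (1 : ℝ) else 1 / (n : ℝ))))) / n :=
    div_nonneg (Finset.sum_nonneg fun S _ => sissR_wt_nonneg S) (Nat.cast_nonneg _)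
  -- members of `t q j` are `none` or trees of `TS d`
  have ht_TS : ∀ (q : Fin k × Fin k) (j : Fin k) (S : Finset (List (Fin k) × (Fin m × ℕ))), some S ∈ t q j → S ∈ TS d := by
    intro q j S h
    simp only [ht] at h
    split_ifs at h with h1 h2
    · simp at h
    · rw [Finset.mem_image] at h
      obtain ⟨S', hS', hSS⟩ := h
      cases hSS
      exact (Finset.mem_filter.1 hS').1
    · rw [Finset.mem_image] at h
      obtain ⟨S', hS', hSS⟩ := h
      cases hSS
      exact (Finset.mem_filter.1 hS').1
  -- (1) decomposition: index by (clause, childless slot, recent slot), the two slots distinct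
  have hdecomp : ∀ T ∈ (TS (d + 1)).filter (fun T => (((∀ e ∈ T, ∀ (j : Fin k) (y : Fin m) (s : ℕ), (j :: e.1, (y, s)) ∈ T →
        s / 2 < e.2.2 / 2 ∧ ∃ j' : Fin k, ∀ lab : Fin m × ℕ, (j' :: j :: e.1, lab) ∉ T) ∧
      (∀ e ∈ T, ∀ (j : Fin k) (y : Fin m) (s : ℕ), (j :: e.1, (y, s)) ∈ T → s % 2 = 1 →
        ∀ j₁ j₂ : Fin k, (∀ lab : Fin m × ℕ, (j₁ :: j :: e.1, lab) ∉ T) →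
          (∀ lab : Fin m × ℕ, (j₂ :: j :: e.1, lab) ∉ T) → j₁ = j₂) ∧
      (∀ e ∈ T, 1 ≤ e.2.2 / 2 → ∃ (j : Fin k) (y : Fin m) (s : ℕ),
        (j :: e.1, (y, s)) ∈ T ∧ s / 2 + 1 = e.2.2 / 2))) ∧
        (∃ y : Fin m, (([] : List (Fin k)), (y, r)) ∈ T) ∧
        (∃ (j : Fin k) (y : Fin m) (s : ℕ), ([j], (y, s)) ∈ T ∧ s / 2 + 1 = r / 2) ∧
        ∃ j₀ : Fin k, (∀ lab : Fin m × ℕ, ([j₀], lab) ∉ T) ∧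
          ∀ j : Fin k, j ≠ j₀ → ∃ lab : Fin m × ℕ, ([j], lab) ∈ T),
      ∃ p ∈ (univ : Finset (Fin m)) ×ˢ (univ : Finset (Fin k)).offDiag,
        T ∈ (Fintype.piFinset (t p.2)).image (fun ch => asm p.1 r ch) := by
    intro T hT
    rw [Finset.mem_filter] at hT
    obtain ⟨hTS, hloc, ⟨y, hy⟩, ⟨j₁, y₁, s₁, hy₁, hs₁⟩, j₀, hj₀, hfull⟩ := hT
    obtain ⟨c, r', _, ch, hch, rfl⟩ := (hTSs d _).1 hTS
    have hrr : r' = r := by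
      have := (sissR_asm_mem_nil asm hasm c r' ch (y, r)).1 hy
      exact ((Prod.mk.inj this).2).symm
    subst hrr
    have hroots : ∀ (j : Fin k) (S : Finset (List (Fin k) × (Fin m × ℕ))), ch j = some S →
        ∃ lab : Fin m × ℕ, (([] : List (Fin k)), lab) ∈ S := by
      intro j S hS
      obtain ⟨⟨c', r'', _, h⟩, _⟩ := sissR_TS_valid asm hasm TS L hTS0 hTSs d S (hch j S hS)
      exact ⟨(c', r''), h⟩
    obtain ⟨hsub, _⟩ := sissW_locv_asm_imp asm hasm c r' ch hroots hloc
    have hj01 : j₀ ≠ j₁ := by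
      rintro rfl
      exact hj₀ _ hy₁
    refine ⟨(c, (j₀, j₁)), ?_, ?_⟩
    · rw [Finset.mem_product, Finset.mem_offDiag]
      exact ⟨mem_univ _, mem_univ _, mem_univ _, hj01⟩
    rw [Finset.mem_image]
    refine ⟨ch, ?_, rfl⟩
    rw [Fintype.mem_piFinset]
    intro j
    simp only [ht]
    split_ifs with h1 h2
    · -- the childless slot: no subtree
      subst h1
      rw [Finset.mem_singleton]
      cases hS : ch j with
      | none => rfl
      | some S =>
        obtain ⟨lab, hlab⟩ := hroots j S hS
        exact absurd ((sissR_asm_mem_single asm hasm c r' ch j lab).2 ⟨S, hS, hlab⟩) (hj₀ lab)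
    · -- the recent slot
      subst h2
      obtain ⟨S, hS, hyS⟩ := (sissR_asm_mem_single asm hasm c r' ch j (y₁, s₁)).1 hy₁
      rw [hS, Finset.mem_image]
      refine ⟨S, ?_, rfl⟩
      rw [hRec, Finset.mem_filter]
      obtain ⟨hl, hn, hu, _⟩ := hsub j S hS
      exact ⟨hch j S hS, hl, hn, hu, y₁, s₁, hyS, hs₁⟩
    · -- another slot: it bears a child
      obtain ⟨lab, hlab⟩ := hfull j h1
      obtain ⟨S, hS, hlabS⟩ := (sissR_asm_mem_single asm hasm c r' ch j lab).1 hlab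
      rw [hS, Finset.mem_image]
      refine ⟨S, ?_, rfl⟩
      rw [hU, Finset.mem_filter]
      obtain ⟨hl, hn, hu, hlt⟩ := hsub j S hS
      exact ⟨hch j S hS, hl, hn, hu, lab.1, lab.2, hlabS, hlt lab.1 lab.2 hlabS⟩
  refine (sissR_sum_cover_le _ _ _ _ sissR_wt_nonneg hdecomp).trans ?_
  have hinner : ∀ p ∈ (univ : Finset (Fin m)) ×ˢ (univ : Finset (Fin k)).offDiag,
      ∑ T ∈ (Fintype.piFinset (t p.2)).image (fun ch => asm p.1 r ch), (∏ e ∈ T, ((1 / 2 : ℝ) ^ k * (if e.1 = [] then (1 : ℝ) else 1 / (n : ℝ))))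
        ≤ (1 / 2 : ℝ) ^ k * (((∑ S ∈ Rec, (∏ e ∈ S, ((1 / 2 : ℝ) ^ k * (if e.1 = [] then (1 : ℝ) else 1 / (n : ℝ))))) / n) * ((∑ S ∈ U, (∏ e ∈ S, ((1 / 2 : ℝ) ^ k * (if e.1 = [] then (1 : ℝ) else 1 / (n : ℝ))))) / n) ^ (k - 2)) := by
    rintro ⟨c, j₀, j₁⟩ hp
    rw [Finset.mem_product, Finset.mem_offDiag] at hp
    have hj01 : j₀ ≠ j₁ := hp.2.2.2
    refine (Finset.sum_image_le_of_nonneg fun T _ => sissR_wt_nonneg T).trans ?_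
    have hw : ∀ ch ∈ Fintype.piFinset (t (j₀, j₁)),
        (∏ e ∈ asm c r ch, ((1 / 2 : ℝ) ^ k * (if e.1 = [] then (1 : ℝ) else 1 / (n : ℝ)))) = (1 / 2 : ℝ) ^ k * ∏ j : Fin k, f (ch j) := by
      intro ch hch
      rw [Fintype.mem_piFinset] at hch
      refine sissR_wt_asm asm hasm c r ch fun j S hS => ?_
      exact sissR_TS_rootCount asm hasm TS L hTS0 hTSs d S (ht_TS (j₀, j₁) j S (by rw [← hS]; exact hch j))
    rw [Finset.sum_congr rfl hw, ← Finset.mul_sum, ← Finset.prod_univ_sum]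
    refine mul_le_mul_of_nonneg_left (le_of_eq ?_) (pow_nonneg (by norm_num) _)
    have hA : ∑ o ∈ Rec.image some, f o = (∑ S ∈ Rec, (∏ e ∈ S, ((1 / 2 : ℝ) ^ k * (if e.1 = [] then (1 : ℝ) else 1 / (n : ℝ))))) / n := by
      rw [Finset.sum_image (fun S _ S' _ h => Option.some_injective _ h)]
      simp only [hf, Option.elim_some]
      rw [Finset.sum_div]
    have hB : ∑ o ∈ U.image some, f o = (∑ S ∈ U, (∏ e ∈ S, ((1 / 2 : ℝ) ^ k * (if e.1 = [] then (1 : ℝ) else 1 / (n : ℝ))))) / n := by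
      rw [Finset.sum_image (fun S _ S' _ h => Option.some_injective _ h)]
      simp only [hf, Option.elim_some]
      rw [Finset.sum_div]
    have hN : ∑ o ∈ ({none} : Finset (Option (Finset (List (Fin k) × (Fin m × ℕ))))), f o = 1 := by
      rw [Finset.sum_singleton]; simp [hf]
    have hj1mem : j₁ ∈ (univ : Finset (Fin k)).erase j₀ := Finset.mem_erase.2 ⟨hj01.symm, mem_univ _⟩
    rw [← Finset.mul_prod_erase (univ : Finset (Fin k)) _ (mem_univ j₀),
      ← Finset.mul_prod_erase ((univ : Finset (Fin k)).erase j₀) _ hj1mem]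
    have ht0 : t (j₀, j₁) j₀ = {none} := by simp only [ht, if_pos rfl]
    have ht1 : t (j₀, j₁) j₁ = Rec.image some := by simp only [ht, if_neg hj01.symm, if_true]
    have ht2 : ∀ j ∈ ((univ : Finset (Fin k)).erase j₀).erase j₁, t (j₀, j₁) j = U.image some := by
      intro j hj
      simp only [ht, if_neg (Finset.ne_of_mem_erase (Finset.mem_of_mem_erase hj)),
        if_neg (Finset.ne_of_mem_erase hj)]
    have hk2 : k - 1 - 1 = k - 2 := by omega
    rw [ht0, ht1, Finset.prod_congr rfl (fun j hj => by rw [ht2 j hj]), hN, hA, one_mul, Finset.prod_const,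
      Finset.card_erase_of_mem hj1mem, Finset.card_erase_of_mem (mem_univ j₀), Finset.card_univ,
      Fintype.card_fin, hB, hk2]
  refine (Finset.sum_le_sum hinner).trans ?_
  rw [Finset.sum_const, Finset.card_product, Finset.card_univ, Fintype.card_fin, Finset.offDiag_card,
    Finset.card_univ, Fintype.card_fin, nsmul_eq_mul]
  have hkk : ((m * (k * k - k) : ℕ) : ℝ) ≤ (m : ℝ) * k * k := by
    have : m * (k * k - k) ≤ m * (k * k) := Nat.mul_le_mul_left _ (Nat.sub_le _ _)
    calc ((m * (k * k - k) : ℕ) : ℝ) ≤ ((m * (k * k) : ℕ) : ℝ) := by exact_mod_cast this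
      _ = (m : ℝ) * k * k := by push_cast; ring
  have hP : 0 ≤ (1 / 2 : ℝ) ^ k * (((∑ S ∈ Rec, (∏ e ∈ S, ((1 / 2 : ℝ) ^ k * (if e.1 = [] then (1 : ℝ) else 1 / (n : ℝ))))) / n) * ((∑ S ∈ U, (∏ e ∈ S, ((1 / 2 : ℝ) ^ k * (if e.1 = [] then (1 : ℝ) else 1 / (n : ℝ))))) / n) ^ (k - 2)) :=
    by positivity
  calc ((m * (k * k - k) : ℕ) : ℝ) *
        ((1 / 2 : ℝ) ^ k * (((∑ S ∈ Rec, (∏ e ∈ S, ((1 / 2 : ℝ) ^ k * (if e.1 = [] then (1 : ℝ) else 1 / (n : ℝ))))) / n) * ((∑ S ∈ U, (∏ e ∈ S, ((1 / 2 : ℝ) ^ k * (if e.1 = [] then (1 : ℝ) else 1 / (n : ℝ))))) / n) ^ (k - 2)))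
      ≤ ((m : ℝ) * k * k) *
        ((1 / 2 : ℝ) ^ k * (((∑ S ∈ Rec, (∏ e ∈ S, ((1 / 2 : ℝ) ^ k * (if e.1 = [] then (1 : ℝ) else 1 / (n : ℝ))))) / n) * ((∑ S ∈ U, (∏ e ∈ S, ((1 / 2 : ℝ) ^ k * (if e.1 = [] then (1 : ℝ) else 1 / (n : ℝ))))) / n) ^ (k - 2))) :=
        mul_le_mul_of_nonneg_right hkk hP
    _ = _ := by ring

/-- **Weight of the codes of root round `0`** (`k ≥ 2`). The locally valid codes of `TS (d+1)` with
root round `0` and the uniqueness constraint at an odd root are bare roots of code `0` (children would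
have smaller rounds; a bare root of code `1` has `k ≥ 2` childless slots): total weight `≤ m·2^{-k}`. -/
theorem sissW_weight_zero (asm : Fin m → ℕ → (Fin k → Option (Finset (List (Fin k) × (Fin m × ℕ)))) → Finset (List (Fin k) × (Fin m × ℕ)))
    (hasm : ∀ (c : Fin m) (r : ℕ) (ch : Fin k → Option (Finset (List (Fin k) × (Fin m × ℕ))))
      (e : (List (Fin k) × (Fin m × ℕ))), e ∈ asm c r ch ↔ (e = ([], (c, r)) ∨
      ∃ (j : Fin k) (S : Finset (List (Fin k) × (Fin m × ℕ))), ch j = some S ∧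
        ∃ b : List (Fin k), (b, e.2) ∈ S ∧ e.1 = b ++ [j]))
    (TS : ℕ → Finset (Finset (List (Fin k) × (Fin m × ℕ)))) (L : ℕ)
    (hTS0 : ∀ T : Finset (List (Fin k) × (Fin m × ℕ)), T ∈ TS 0 ↔
      ∃ (c : Fin m) (r : ℕ), r ≤ L ∧ T = asm c r (fun _ => none))
    (hTSs : ∀ (d : ℕ) (T : Finset (List (Fin k) × (Fin m × ℕ))), T ∈ TS (d + 1) ↔
      ∃ (c : Fin m) (r : ℕ), r ≤ L ∧ ∃ ch : Fin k → Option (Finset (List (Fin k) × (Fin m × ℕ))),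
        (∀ (j : Fin k) (S : Finset (List (Fin k) × (Fin m × ℕ))), ch j = some S → S ∈ TS d) ∧ T = asm c r ch)
    (hk : 2 ≤ k) (d : ℕ) :
    ∑ T ∈ (TS (d + 1)).filter (fun T => (((∀ e ∈ T, ∀ (j : Fin k) (y : Fin m) (s : ℕ), (j :: e.1, (y, s)) ∈ T →
        s / 2 < e.2.2 / 2 ∧ ∃ j' : Fin k, ∀ lab : Fin m × ℕ, (j' :: j :: e.1, lab) ∉ T) ∧
      (∀ e ∈ T, ∀ (j : Fin k) (y : Fin m) (s : ℕ), (j :: e.1, (y, s)) ∈ T → s % 2 = 1 →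
        ∀ j₁ j₂ : Fin k, (∀ lab : Fin m × ℕ, (j₁ :: j :: e.1, lab) ∉ T) →
          (∀ lab : Fin m × ℕ, (j₂ :: j :: e.1, lab) ∉ T) → j₁ = j₂) ∧
      (∀ e ∈ T, 1 ≤ e.2.2 / 2 → ∃ (j : Fin k) (y : Fin m) (s : ℕ),
        (j :: e.1, (y, s)) ∈ T ∧ s / 2 + 1 = e.2.2 / 2))) ∧ ((∀ (y : Fin m) (s : ℕ), (([] : List (Fin k)), (y, s)) ∈ T → s % 2 = 1 →
        ∀ j₁ j₂ : Fin k, (∀ lab : Fin m × ℕ, ([j₁], lab) ∉ T) →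
          (∀ lab : Fin m × ℕ, ([j₂], lab) ∉ T) → j₁ = j₂)) ∧
        ∃ (y : Fin m) (r : ℕ), (([] : List (Fin k)), (y, r)) ∈ T ∧ r / 2 = 0), (∏ e ∈ T, ((1 / 2 : ℝ) ^ k * (if e.1 = [] then (1 : ℝ) else 1 / (n : ℝ))))
      ≤ (m : ℝ) * (1 / 2 : ℝ) ^ k := by
  have hdecomp : ∀ T ∈ (TS (d + 1)).filter (fun T => (((∀ e ∈ T, ∀ (j : Fin k) (y : Fin m) (s : ℕ), (j :: e.1, (y, s)) ∈ T →
        s / 2 < e.2.2 / 2 ∧ ∃ j' : Fin k, ∀ lab : Fin m × ℕ, (j' :: j :: e.1, lab) ∉ T) ∧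
      (∀ e ∈ T, ∀ (j : Fin k) (y : Fin m) (s : ℕ), (j :: e.1, (y, s)) ∈ T → s % 2 = 1 →
        ∀ j₁ j₂ : Fin k, (∀ lab : Fin m × ℕ, (j₁ :: j :: e.1, lab) ∉ T) →
          (∀ lab : Fin m × ℕ, (j₂ :: j :: e.1, lab) ∉ T) → j₁ = j₂) ∧
      (∀ e ∈ T, 1 ≤ e.2.2 / 2 → ∃ (j : Fin k) (y : Fin m) (s : ℕ),
        (j :: e.1, (y, s)) ∈ T ∧ s / 2 + 1 = e.2.2 / 2))) ∧ ((∀ (y : Fin m) (s : ℕ), (([] : List (Fin k)), (y, s)) ∈ T → s % 2 = 1 →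
        ∀ j₁ j₂ : Fin k, (∀ lab : Fin m × ℕ, ([j₁], lab) ∉ T) →
          (∀ lab : Fin m × ℕ, ([j₂], lab) ∉ T) → j₁ = j₂)) ∧
        ∃ (y : Fin m) (r : ℕ), (([] : List (Fin k)), (y, r)) ∈ T ∧ r / 2 = 0),
      ∃ c ∈ (univ : Finset (Fin m)), T ∈ ({asm c 0 (fun _ => none)} : Finset (Finset (List (Fin k) × (Fin m × ℕ)))) := by
    intro T hT
    rw [Finset.mem_filter] at hT
    obtain ⟨hTS, hloc, huniq, y, r, hy, hr0⟩ := hT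
    obtain ⟨c, r', _, ch, hch, rfl⟩ := (hTSs d _).1 hTS
    have hrr : r' = r := by
      have := (sissR_asm_mem_nil asm hasm c r' ch (y, r)).1 hy
      exact ((Prod.mk.inj this).2).symm
    subst hrr
    have hyc : y = c := by
      have := (sissR_asm_mem_nil asm hasm c r' ch (y, r')).1 hy
      exact (Prod.mk.inj this).1
    subst hyc
    have hroots : ∀ (j : Fin k) (S : Finset (List (Fin k) × (Fin m × ℕ))), ch j = some S →
        ∃ lab : Fin m × ℕ, (([] : List (Fin k)), lab) ∈ S := by
      intro j S hS
      obtain ⟨⟨c', r'', _, h⟩, _⟩ := sissR_TS_valid asm hasm TS L hTS0 hTSs d S (hch j S hS)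
      exact ⟨(c', r''), h⟩
    obtain ⟨hsub, _⟩ := sissW_locv_asm_imp asm hasm y r' ch hroots hloc
    -- no subtree can have a root round `< 0`
    have hnone : ch = fun _ => none := by
      funext j
      cases hS : ch j with
      | none => rfl
      | some S =>
        exfalso
        obtain ⟨lab, hlab⟩ := hroots j S hS
        have := (hsub j S hS).2.2.2 lab.1 lab.2 hlab
        omega
    subst hnone
    -- the code is `0`: an odd bare root has two childless slots
    have hno : ∀ (j : Fin k) (lab : Fin m × ℕ), ([j], lab) ∉ asm y r' (fun _ => none) := by
      intro j lab h
      obtain ⟨S, hS, _⟩ := (sissR_asm_mem_single asm hasm y r' _ j lab).1 h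
      exact absurd hS (by simp)
    have hr' : r' = 0 := by
      rcases Nat.even_or_odd r' with ⟨t, ht⟩ | ⟨t, ht⟩
      · omega
      · exfalso
        have hodd : r' % 2 = 1 := by omega
        have h01 := huniq y r' hy hodd ⟨0, by omega⟩ ⟨1, by omega⟩ (hno _) (hno _)
        exact absurd (Fin.mk.inj_iff.1 h01) (by norm_num)
    subst hr'
    exact ⟨y, mem_univ _, Finset.mem_singleton_self _⟩
  refine (sissR_sum_cover_le _ _ _ _ sissR_wt_nonneg hdecomp).trans ?_
  have hinner : ∀ c : Fin m, ∑ T ∈ ({asm c 0 (fun _ => none)} : Finset (Finset (List (Fin k) × (Fin m × ℕ)))), (∏ e ∈ T, ((1 / 2 : ℝ) ^ k * (if e.1 = [] then (1 : ℝ) else 1 / (n : ℝ))))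
      = (1 / 2 : ℝ) ^ k := by
    intro c
    rw [Finset.sum_singleton, sissR_wt_asm asm hasm c 0 (fun _ => none) (fun j S hS => absurd hS (by simp))]
    simp
  rw [Finset.sum_congr rfl (fun c _ => hinner c), Finset.sum_const, Finset.card_univ, Fintype.card_fin,
    nsmul_eq_mul]

/-- **No bare root of round `≥ 1` is locally valid**: it has no recent child. -/
theorem sissW_weight_base_empty (asm : Fin m → ℕ → (Fin k → Option (Finset (List (Fin k) × (Fin m × ℕ)))) → Finset (List (Fin k) × (Fin m × ℕ)))
    (hasm : ∀ (c : Fin m) (r : ℕ) (ch : Fin k → Option (Finset (List (Fin k) × (Fin m × ℕ))))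
      (e : (List (Fin k) × (Fin m × ℕ))), e ∈ asm c r ch ↔ (e = ([], (c, r)) ∨
      ∃ (j : Fin k) (S : Finset (List (Fin k) × (Fin m × ℕ))), ch j = some S ∧
        ∃ b : List (Fin k), (b, e.2) ∈ S ∧ e.1 = b ++ [j]))
    (TS : ℕ → Finset (Finset (List (Fin k) × (Fin m × ℕ)))) (L : ℕ)
    (hTS0 : ∀ T : Finset (List (Fin k) × (Fin m × ℕ)), T ∈ TS 0 ↔
      ∃ (c : Fin m) (r : ℕ), r ≤ L ∧ T = asm c r (fun _ => none))
    (s : ℕ) (hs : 1 ≤ s) :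
    (TS 0).filter (fun T => (((∀ e ∈ T, ∀ (j : Fin k) (y : Fin m) (s : ℕ), (j :: e.1, (y, s)) ∈ T →
        s / 2 < e.2.2 / 2 ∧ ∃ j' : Fin k, ∀ lab : Fin m × ℕ, (j' :: j :: e.1, lab) ∉ T) ∧
      (∀ e ∈ T, ∀ (j : Fin k) (y : Fin m) (s : ℕ), (j :: e.1, (y, s)) ∈ T → s % 2 = 1 →
        ∀ j₁ j₂ : Fin k, (∀ lab : Fin m × ℕ, (j₁ :: j :: e.1, lab) ∉ T) →
          (∀ lab : Fin m × ℕ, (j₂ :: j :: e.1, lab) ∉ T) → j₁ = j₂) ∧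
      (∀ e ∈ T, 1 ≤ e.2.2 / 2 → ∃ (j : Fin k) (y : Fin m) (s : ℕ),
        (j :: e.1, (y, s)) ∈ T ∧ s / 2 + 1 = e.2.2 / 2))) ∧
        ∃ (y : Fin m) (r : ℕ), (([] : List (Fin k)), (y, r)) ∈ T ∧ r / 2 = s) = ∅ := by
  rw [Finset.filter_eq_empty_iff]
  rintro T hT ⟨⟨_, _, hloc3⟩, y, r, hy, hrs⟩
  obtain ⟨c, r', _, rfl⟩ := (hTS0 T).1 hT
  have hrr : r' = r := by
    have := (sissR_asm_mem_nil asm hasm c r' _ (y, r)).1 hy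
    exact ((Prod.mk.inj this).2).symm
  subst hrr
  have hno : ∀ (j : Fin k) (lab : Fin m × ℕ), ([j], lab) ∉ asm c r' (fun _ => none) := by
    intro j lab h
    obtain ⟨S, hS, _⟩ := (sissR_asm_mem_single asm hasm c r' _ j lab).1 h
    exact absurd hS (by simp)
  obtain ⟨j, y', s', hy', _⟩ := hloc3 _ hy (by simp only; omega)
  exact hno j _ hy'

end WeightStepOdd

end Summit.PneNP.PneNP.Theorems
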